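import Summits.HodgeConjecture.HodgeConjecture.Theorems.Ring2AbelianAllAndreWeightRootsTheta
import Literature.AlgebraicGeometry.HodgeTheory.AlgebraicityLocusCurveBaseDichotomy
import Literature.AlgebraicGeometry.HodgeTheory.ThomGysinClosedImmersion
import Literature.AlgebraicGeometry.HodgeTheory.SupportedClassesAdditivity
import Literature.AlgebraicGeometry.HodgeTheory.VerticalSupportLines
import HarnessLib

/-!
# Ring 2 · sub-cell AbelianAll (ALL ABELIAN VARIETIES), André axis, part XXV-e — PURITY ALONG FINITELY MANY FIBRES: the support-form
# clause (gysT) of part XXV-d from the Gysin-form base-change clause (gysFib) "`ν^* ∘ j_{s*} = Nᵃ · j_{s*}` on `Hᵃ(X_s)`"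

HONEST FRAMING (page 1, verbatim): **research route, not a corollary; conditional on HC_CM plus one named
minimal statement.** Cell line: research route conditional on HC_CM; not a corollary; Q11.4-sentence-2
already refuted in dim ≥ 3. Nothing in this file proves a case of the Hodge conjecture for an abelian variety; `HC_CM`
(`RankFourFaces.CMAbelianHodge`) is a HYPOTHESIS of the `HC_AV` row, load-bearing as typed; item `Theses.RankFourFaces.CMToAbelian`
(stmt-16267) OPEN and not closed here. Seat `pub-hodge-ring2-ab-andre-2`, gen 17; brief (iii) "attack `B_min`: what is known".

## What this file proves

Part XXV-d displayed, inside the bracket `CMThetaGysin[]`, the clause (gysT): for every proper Zariski-closed `T ⊊ S`, `ν^*` acts as `N^{k-2}`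
on the classes of `Hᵏ(𝒳)` dying off `f⁻¹T`. HERE (gysT) is PROVED from the clause it abbreviates in print:

* (gysFib) for every point `s` and all degrees `a + 2 = b`: `ν^*(j_{s*} x) = Nᵃ · j_{s*} x` for `x ∈ Hᵃ(X_s)` (`j_{s*}` the tree's Gysin
  morphism `complexGysin` of the fibre inclusion) — in print: base change `θ_N^* ∘ j_{s*} = j_{s*} ∘ θ_N|_{X_s}^*` for the cartesian square
  `X_s ⊂ 𝒳` under `θ_N`, and `[N]^* = Nᵃ` on `Hᵃ(X_s)`.

**`supportWeight_of_gysinWeight`**: (gysFib) ⟹ (gysT). PROOF = PURITY ALONG FINITELY MANY FIBRES, all tree theorems: a proper closed `T` of the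
smooth projective base curve misses the generic point, hence is a finite set of closed points, each underlying a complex point
(`finite_setOf_pt_mem_of_isClosed_of_ne_univ`, `isClosed_singleton_of_ne_top`, `AlgPoints.exists_pt_eq_of_isClosed`); so `f⁻¹T` is a finite
disjoint union of fibres `X_{s_i} = im j_{s_i}`; a class dying off ONE fibre is a Gysin image from it (Thom–Gysin,
`ker_restrictCompl_eq_iSup_range_complexGysin_of_isClosedImmersion`), and kernels of restrictions are additive over DISJOINT closed pieces
(`ker_restrictCompl_union_le`, Mayer–Vietoris); on each Gysin image `ν^*` is `N^{k-2}` by (gysFib).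

Node level (display-only brackets, F-ab-103): **`CMThetaGysinFib[]`** — (θ∀) ∧ (gysFib) at every CM point; **`cmThetaGysin_of_cmThetaGysinFib`**,
**`cmWeights_of_cmThetaGysinFib : CMThetaGysinFib[] → CMWeights[]`**, and the row `HC_AV_of_HC_CM_of_cmTopWeightHodge_of_thetaGysinFib`.

## Honest status

No node is born; nothing is minimal; nothing here is fact-free progress on `HC_AV`. After parts XXV-a…e the displayed weight hypothesis of the
André-axis rows is: the compact pencil carries a locally quasi-finite `S`-endomorphism charted by `[N]` on every fibre (the abelian-scheme
structure, Mumford GIT 6.14) whose pull-back commutes with the Gysin maps of the fibres up to the fibre weight (base change for the cartesian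
squares `X_s ⊂ 𝒳`) — two statements of the algebraic geometry of abelian schemes, no spectral sequence, no purity, no Leray filtration.

References: DeligneHodgeIII1974 (Cor. 8.2.8); VoisinHodgeII2003 (§6.1.1); GrothendieckTopology1969 (§1); Hartshorne1977 (I Prop. 1.5, II Ex. 3.13,
II §3); Milne2020HodgeClassesAV (proof of Prop. 1); MumfordGIT (Thm. 6.14).
-/

noncomputable section

set_option linter.dupNamespace false

namespace Summit.HodgeConjecture.HodgeConjecture.Ring2.AbelianAll

open CategoryTheory CategoryTheory.Limits AlgebraicGeometry
open Literature.AlgebraicGeometry Literature.AlgebraicGeometry.Motives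
open Literature.AlgebraicGeometry.HodgeTheory
open Literature.AlgebraicGeometry.Deligne1982 (cmLocus)
open Literature.AlgebraicGeometry.Andre1996 (andre1996_cmAnchoredPencil)
open Summit.HodgeConjecture.HodgeConjecture
open Summit.HodgeConjecture.HodgeConjecture.Theses

/-! ## §1 Purity along finitely many fibres: (gysFib) ⟹ (gysT) -/

section Purity

variable {𝒳 S : SchemeOver ℂ} {d : ℕ} {f : 𝒳 ⟶ S}

/-- The fibre inclusion `X_s ⟶ 𝒳` has range the set-theoretic fibre `f⁻¹{s}` (`Scheme.Pullback.range_fst`; `Spec ℂ` is one point).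
[cite: Hartshorne1977, II §3 (fibres)] -/
theorem range_fiberι_base_eq_preimage (f : 𝒳 ⟶ S) (s : ComplexPoints S) :
    Set.range (fiberι f s).left.base = f.left.base ⁻¹' {s.pt} := by
  haveI : Subsingleton ((Motives.specOver ℂ ℂ).left : Type) := inferInstanceAs (Subsingleton (PrimeSpectrum ℂ))
  rw [Motives.fiberι_left]
  erw [Scheme.Pullback.range_fst]
  congr 1
  ext x
  simp only [Set.mem_range, Set.mem_singleton_iff]
  constructor
  · rintro ⟨y, rfl⟩
    rw [Subsingleton.elim y (IsLocalRing.closedPoint ℂ)]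
    rfl
  · intro hx
    exact ⟨IsLocalRing.closedPoint ℂ, hx.symm⟩

/-- **(gysFib) ⟹ (gysT): the weight of classes supported on finitely many fibres.** Let `f : 𝒳 ⟶ S` be a compact pencil of abelian `d`-folds and
`ν : 𝒳 ⟶ 𝒳` with `ν^*(j_{s*} x) = Nᵃ · j_{s*} x` for every point `s`, all `a + 2 = b` and `x ∈ Hᵃ(X_s)` (`j_{s*} = complexGysin` of the fibre
inclusion). Then for every proper Zariski-closed `T ⊊ S`, every class `u ∈ Hᵏ(𝒳)` dying off `f⁻¹T` satisfies `ν^* u = N^{k-2} u`: `T` is a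
finite set of closed points, each a complex point; `f⁻¹T` is the disjoint union of the corresponding fibres; classes dying off one fibre are
Gysin images (Thom–Gysin) and kernels of restrictions add up over disjoint closed pieces (Mayer–Vietoris).
[cite: DeligneHodgeIII1974, Cor. 8.2.8] [cite: VoisinHodgeII2003, §6.1.1 (Thom–Gysin)] [cite: GrothendieckTopology1969, §1]
[cite: Hartshorne1977, Ch. I Prop. 1.5 and Ch. II Ex. 3.13] -/
theorem supportWeight_of_gysinWeight (hf : IsCompactAbelianPencil f d) (ν : 𝒳 ⟶ 𝒳) (N : ℕ)
    (hgys : ∀ (s : ComplexPoints S) (a b : ℕ) (hab : a + 2 * (d + 1) = b + 2 * d) (x : complexBetti (fiberOver f s) a),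
      complexBetti.map ν b (complexGysin complexOrientationFamily (hf.isSmoothProjective_fiberOver s) hf.isSmoothProjective_total
        (fiberι f s) hab x) =
        ((N : ℂ) ^ a) • complexGysin complexOrientationFamily (hf.isSmoothProjective_fiberOver s) hf.isSmoothProjective_total
          (fiberι f s) hab x)
    (T : Set S.left) (hT : IsClosed T) (hTu : T ≠ Set.univ) (k : ℕ) (u : complexBetti 𝒳 k)
    (hu : complexBetti.restrictCompl 𝒳 (f.left.base ⁻¹' T) k u = 0) :
    complexBetti.map ν k u = ((N : ℂ) ^ (k - 2)) • u := by
  classical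
  have hX := hf.isSmoothProjective_total
  haveI : IsIntegral S.left := IsSmoothProjective.isIntegral_holds hf.isSmoothProjective_base
  haveI : SmoothOfRelativeDimension 1 S.hom := hf.isSmoothProjective_base.smoothOfRelativeDimension
  haveI : Smooth S.hom := SmoothOfRelativeDimension.smooth 1 _
  haveI : LocallyOfFiniteType S.hom := inferInstance
  haveI : IsProper S.hom := hf.isSmoothProjective_base.isProjectiveOver.isProper
  haveI : IsSeparated S.hom := inferInstance
  haveI : IsLocallyNoetherian S.left := LocallyOfFiniteType.isLocallyNoetherian S.hom
  haveI : CompactSpace S.left := QuasiCompact.compactSpace_of_compactSpace S.hom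
  haveI : IsNoetherian S.left := {}
  haveI : TopologicalSpace.NoetherianSpace S.left := inferInstance
  -- the target submodule: the `N^{k-2}`-eigenspace of `ν^*`
  set Good : Submodule ℂ (complexBetti 𝒳 k) :=
    LinearMap.ker ((complexBetti.map ν k).hom - ((N : ℂ) ^ (k - 2)) • LinearMap.id) with hGood
  have hGoodmem : ∀ v : complexBetti 𝒳 k, v ∈ Good ↔ complexBetti.map ν k v = ((N : ℂ) ^ (k - 2)) • v := fun v ↦ by
    rw [hGood, LinearMap.mem_ker, LinearMap.sub_apply, LinearMap.smul_apply, LinearMap.id_apply, sub_eq_zero]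
  -- the fibres: `Z s = f⁻¹{s} = im j_s`
  let Z : ComplexPoints S → Set 𝒳.left := fun s ↦ Set.range (fiberι f s).left.base
  have hZc : ∀ s, IsClosed (Z s) := fun s ↦ by
    haveI := Motives.isClosedImmersion_fiberι_left f s
    exact (fiberι f s).left.isClosedEmbedding.isClosed_range
  -- one fibre: Thom–Gysin purity and (gysFib)
  have hone : ∀ s, LinearMap.ker (complexBetti.restrictCompl 𝒳 (Z s) k).hom ≤ Good := by
    intro s
    haveI := Motives.isClosedImmersion_fiberι_left f s
    rw [ker_restrictCompl_eq_iSup_range_complexGysin_of_isClosedImmersion complexOrientationFamily hX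
      (hf.isSmoothProjective_fiberOver s) (fiberι f s) k]
    refine iSup₂_le fun a hab ↦ ?_
    rintro _ ⟨x, rfl⟩
    rw [hGoodmem]
    have ha : a = k - 2 := by omega
    rw [← ha]
    exact hgys s a k hab x
  -- finitely many fibres: additivity of kernels over disjoint closed pieces
  have hfin : ∀ G : Finset (ComplexPoints S),
      LinearMap.ker (complexBetti.restrictCompl 𝒳 (⋃ s ∈ G, Z s) k).hom ≤ Good := by
    intro G
    induction G using Finset.induction_on with
    | empty =>
      intro a ha
      have ha' : complexBetti.restrictCompl 𝒳 (⋃ s ∈ (∅ : Finset (ComplexPoints S)), Z s) k a = 0 := ha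
      have he : (⋃ s ∈ (∅ : Finset (ComplexPoints S)), Z s) = (∅ : Set 𝒳.left) := by simp
      rw [he] at ha'
      have hinj := injective_restrictCompl_of_le_coheight hX isClosed_empty (c := k + 1)
        (fun z hz ↦ (Set.notMem_empty z hz).elim) (i := k) (by omega)
      have h0 : a = 0 := hinj (by rw [ha', map_zero])
      rw [h0]
      exact Submodule.zero_mem _
    | insert s G hsG ih =>
      have hU : IsClosed (⋃ s' ∈ G, Z s') := G.finite_toSet.isClosed_biUnion fun s' _ ↦ hZc s'
      have he : (⋃ s' ∈ insert s G, Z s') = Z s ∪ ⋃ s' ∈ G, Z s' := by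
        rw [Finset.set_biUnion_insert]
      rw [he]
      have hint : ∀ t ∈ Z s ∩ ⋃ s' ∈ G, Z s', ((k + 1 : ℕ) : ℕ∞) ≤ Order.coheight t := by
        rintro y ⟨hy, hy'⟩
        exfalso
        obtain ⟨s', hs'G, hys'⟩ := Set.mem_iUnion₂.1 hy'
        have h1 : f.left.base y = s.pt := by
          have h := (range_fiberι_base_eq_preimage f s).subset hy
          exact h
        have h2 : f.left.base y = s'.pt := by
          have h := (range_fiberι_base_eq_preimage f s').subset hys'
          exact h
        have hss' : s = s' := Motives.ComplexPoints.ext_of_pt_eq (h1.symm.trans h2)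
        exact hsG (hss' ▸ hs'G)
      calc LinearMap.ker (complexBetti.restrictCompl 𝒳 (Z s ∪ ⋃ s' ∈ G, Z s') k).hom
          ≤ LinearMap.ker (complexBetti.restrictCompl 𝒳 (Z s) k).hom ⊔
              LinearMap.ker (complexBetti.restrictCompl 𝒳 (⋃ s' ∈ G, Z s') k).hom :=
            ker_restrictCompl_union_le hX (hZc s) hU hint (by omega)
        _ ≤ Good := sup_le (hone s) ih
  -- `f⁻¹T` lies in the union of the fibres over the finitely many complex points of `T`
  have hF : {t : ComplexPoints S | t.pt ∈ T}.Finite := finite_setOf_pt_mem_of_isClosed_of_ne_univ hT hTu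
  have hsub : f.left.base ⁻¹' T ⊆ ⋃ s ∈ hF.toFinset, Z s := by
    intro y hy
    have hyT : f.left.base y ∈ T := hy
    have hne : f.left.base y ≠ ⊤ := fun h ↦ top_notMem_of_isClosed_of_ne_univ hT hTu (h ▸ hyT)
    obtain ⟨s, hs⟩ := AlgPoints.exists_pt_eq_of_isClosed (L := ℂ) (f.left.base y) (isClosed_singleton_of_ne_top hne)
    refine Set.mem_iUnion₂.2 ⟨s, ?_, ?_⟩
    · rw [Set.Finite.mem_toFinset]
      change s.pt ∈ T
      rw [hs]; exact hyT
    · change y ∈ Set.range (fiberι f s).left.base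
      rw [range_fiberι_base_eq_preimage]
      exact hs.symm
  have hmem : u ∈ LinearMap.ker (complexBetti.restrictCompl 𝒳 (⋃ s ∈ hF.toFinset, Z s) k).hom :=
    ker_restrictCompl_le_of_subset hsub k (show u ∈ LinearMap.ker (complexBetti.restrictCompl 𝒳 (f.left.base ⁻¹' T) k).hom from hu)
  exact (hGoodmem u).1 (hfin hF.toFinset hmem)

end Purity

/-! ## §2 Node level (display-only brackets): `CMThetaGysinFib[] ⟹ CMThetaGysin[] ⟹ CMWeights[]` and the row -/

section Nodes

/-- DISPLAY-ONLY bracket (no `def`; REFEREE-AB F-ab-103): `CMWeights[]` of part XXIV-c, restated verbatim. -/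
local notation3 (prettyPrint := false) "CMWeights[]" =>
  ∀ ⦃d : ℕ⦄ ⦃𝒳 S : SchemeOver ℂ⦄ (f : 𝒳 ⟶ S), IsCompactAbelianPencil f d → ∀ t ∈ cmLocus f d,
    ∃ (ν : 𝒳 ⟶ 𝒳) (_ : LocallyQuasiFinite ν.left) (N : ℕ), 2 ≤ N ∧
      (∀ (k : ℕ) (w : complexBetti 𝒳 k), complexBetti.map (fiberι f t) k (complexBetti.map ν k w) =
        ((N : ℂ) ^ k) • complexBetti.map (fiberι f t) k w) ∧
      (∀ (k k₁ k₂ : ℕ), k₁ + 1 = k → k₂ + 1 = k₁ → ∀ w : complexBetti 𝒳 k, ∃ w₀ w₁ w₂ : complexBetti 𝒳 k,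
        w = w₀ + w₁ + w₂ ∧ complexBetti.map ν k w₀ = ((N : ℂ) ^ k) • w₀ ∧ complexBetti.map ν k w₁ = ((N : ℂ) ^ k₁) • w₁ ∧
        complexBetti.map ν k w₂ = ((N : ℂ) ^ k₂) • w₂) ∧
      (∀ (k : ℕ) (G : complexBetti 𝒳 k), complexBetti.map ν k G = ((N : ℂ) ^ k) • G →
        complexBetti.map (fiberι f t) k G = 0 → G = 0)

/-- DISPLAY-ONLY bracket (no `def`; REFEREE-AB F-ab-103): `CMThetaGysin[]` of part XXV-d, restated verbatim. -/
local notation3 (prettyPrint := false) "CMThetaGysin[]" =>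
  ∀ ⦃d : ℕ⦄ ⦃𝒳 S : SchemeOver ℂ⦄ (f : 𝒳 ⟶ S), IsCompactAbelianPencil f d → ∀ t ∈ cmLocus f d,
    ∃ (ν : 𝒳 ⟶ 𝒳) (_ : LocallyQuasiFinite ν.left) (N : ℕ), 2 ≤ N ∧ ν ≫ f = f ∧
      (∀ s : ComplexPoints S, ∃ (νs : fiberOver f s ⟶ fiberOver f s) (A : AbelianVariety ℂ) (e : A.X ≅ fiberOver f s),
        νs ≫ fiberι f s = fiberι f s ≫ ν ∧ e.hom ≫ νs = (N • 𝟙 A).hom.hom.hom ≫ e.hom) ∧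
      (∀ (T : Set S.left), IsClosed T → T ≠ Set.univ → ∀ (k : ℕ) (u : complexBetti 𝒳 k),
        complexBetti.restrictCompl 𝒳 (f.left.base ⁻¹' T) k u = 0 → complexBetti.map ν k u = ((N : ℂ) ^ (k - 2)) • u)

/-- DISPLAY-ONLY bracket (no `def`; REFEREE-AB F-ab-103): `CMTopWeightHodge[]` of part XXIV-d, restated verbatim. OPEN; a HYPOTHESIS. -/
local notation3 (prettyPrint := false) "CMTopWeightHodge[]" =>
  ∀ ⦃d : ℕ⦄ ⦃𝒳 S : SchemeOver ℂ⦄ (f : 𝒳 ⟶ S), IsCompactAbelianPencil f d → ∀ t ∈ cmLocus f d,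
    ∀ (ν : 𝒳 ⟶ 𝒳) (_ : LocallyQuasiFinite ν.left) (N : ℕ), 2 ≤ N →
      (∀ (k : ℕ) (w : complexBetti 𝒳 k), complexBetti.map (fiberι f t) k (complexBetti.map ν k w) =
        ((N : ℂ) ^ k) • complexBetti.map (fiberι f t) k w) →
      (∀ (k k₁ k₂ : ℕ), k₁ + 1 = k → k₂ + 1 = k₁ → ∀ w : complexBetti 𝒳 k, ∃ w₀ w₁ w₂ : complexBetti 𝒳 k,
        w = w₀ + w₁ + w₂ ∧ complexBetti.map ν k w₀ = ((N : ℂ) ^ k) • w₀ ∧ complexBetti.map ν k w₁ = ((N : ℂ) ^ k₁) • w₁ ∧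
        complexBetti.map ν k w₂ = ((N : ℂ) ^ k₂) • w₂) →
      (∀ (k : ℕ) (G : complexBetti 𝒳 k), complexBetti.map ν k G = ((N : ℂ) ^ k) • G →
        complexBetti.map (fiberι f t) k G = 0 → G = 0) →
      ∀ (p : ℕ) (y₀ : complexBetti 𝒳 (2 * (p + 1))),
        complexBetti.map ν (2 * (p + 1)) y₀ = ((N : ℂ) ^ (2 * (p + 1))) • y₀ → IsRationalClass y₀ →
        IsOfHodgeType (d + 1) 𝒳 (2 * (p + 1)) (p + 1) (p + 1) y₀ → y₀ ∈ algebraicClasses 𝒳 (p + 1)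

/-- DISPLAY-ONLY bracket (no `def`, not a census node — REFEREE-AB F-ab-103): **`CMThetaGysinFib[]`** — at every CM point of every compact abelian
pencil there are a locally quasi-finite `S`-ENDOMORPHISM `ν` and `N ≥ 2` such that (θ∀) `ν` restricts on every fibre to an endomorphism charted by
`N · 𝟙_A` (print: `θ_N`; Mumford GIT Thm. 6.14 with rigidity) and (gysFib) `ν^*(j_{s*} x) = Nᵃ · j_{s*} x` for every point `s`, all `a + 2 = b`,
`x ∈ Hᵃ(X_s)` (print: base change `θ_N^* j_{s*} = j_{s*} θ_N|^*` for the cartesian square `X_s ⊂ 𝒳`, and `[N]^* = Nᵃ`). PRINT THEOREMS of the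
algebraic geometry of abelian schemes, displayed; NO spectral sequence, NO purity statement among them. -/
local notation3 (prettyPrint := false) "CMThetaGysinFib[]" =>
  ∀ ⦃d : ℕ⦄ ⦃𝒳 S : SchemeOver ℂ⦄ (f : 𝒳 ⟶ S) (hf : IsCompactAbelianPencil f d), ∀ t ∈ cmLocus f d,
    ∃ (ν : 𝒳 ⟶ 𝒳) (_ : LocallyQuasiFinite ν.left) (N : ℕ), 2 ≤ N ∧ ν ≫ f = f ∧
      (∀ s : ComplexPoints S, ∃ (νs : fiberOver f s ⟶ fiberOver f s) (A : AbelianVariety ℂ) (e : A.X ≅ fiberOver f s),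
        νs ≫ fiberι f s = fiberι f s ≫ ν ∧ e.hom ≫ νs = (N • 𝟙 A).hom.hom.hom ≫ e.hom) ∧
      (∀ (s : ComplexPoints S) (a b : ℕ) (hab : a + 2 * (d + 1) = b + 2 * d) (x : complexBetti (fiberOver f s) a),
        complexBetti.map ν b (complexGysin complexOrientationFamily (hf.isSmoothProjective_fiberOver s) hf.isSmoothProjective_total
          (fiberι f s) hab x) =
          ((N : ℂ) ^ a) • complexGysin complexOrientationFamily (hf.isSmoothProjective_fiberOver s) hf.isSmoothProjective_total
            (fiberι f s) hab x)

/-- **`CMThetaGysinFib[] ⟹ CMThetaGysin[]`** (§1 at each CM point). [cite: DeligneHodgeIII1974, Cor. 8.2.8] [cite: VoisinHodgeII2003, §6.1.1] -/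
theorem cmThetaGysin_of_cmThetaGysinFib (hΘ : CMThetaGysinFib[]) : CMThetaGysin[] := by
  intro d 𝒳 S f hf t ht
  obtain ⟨ν, hν, N, hN, hνf, hθ, hgys⟩ := hΘ f hf t ht
  exact ⟨ν, hν, N, hN, hνf, hθ, fun T hT hTu k u hu ↦ supportWeight_of_gysinWeight hf ν N hgys T hT hTu k u hu⟩

/-- **`CMThetaGysinFib[] ⟹ CMWeights[]`**: the Leray weight package of part XXIV from the abelian-scheme structure and the base change for the
Gysin maps of the fibres (parts XXV-a, XXV-d, §1). [cite: Milne2020HodgeClassesAV, proof of Prop. 1 (p. 7)] [cite: MumfordGIT, Thm. 6.14]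
[cite: DeligneHodgeIII1974, Cor. 8.2.8] -/
theorem cmWeights_of_cmThetaGysinFib (hΘ : CMThetaGysinFib[]) : CMWeights[] :=
  cmWeights_of_cmThetaGysin (cmThetaGysin_of_cmThetaGysinFib hΘ)

/-- **`HC_CM ∧ [CM top-weight Hodge classes algebraic] ⟹ HC_AV`, granted [h₂₁] and `CMThetaGysinFib[]`** (binders in this order; `HC_CM` =
`RankFourFaces.CMAbelianHodge` a HYPOTHESIS, load-bearing): the deliverable row of part XXIV-d with its weight bracket replaced by the two
algebro-geometric clauses (θ∀), (gysFib). research route, not a corollary; conditional on HC_CM plus one named minimal statement.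
[cite: Andre1996Motifs, Lemme 6.3.1 (p. 31) and Remarque 2 (p. 33)] [cite: Milne2020HodgeClassesAV, proof of Prop. 1 (pp. 7–8)] -/
theorem HC_AV_of_HC_CM_of_cmTopWeightHodge_of_thetaGysinFib (h₂₁ : andre1996_cmAnchoredPencil) (hΘ : CMThetaGysinFib[])
    (hCM : RankFourFaces.CMAbelianHodge) (h : CMTopWeightHodge[]) : PadicSemiregularLift.HodgeAbelianVarieties :=
  HC_AV_of_HC_CM_of_cmTopWeightHodge_of_thetaGysin h₂₁ (cmThetaGysin_of_cmThetaGysinFib hΘ) hCM h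

/-- **EXACTNESS: `HC_AV ⟺ HC_CM ∧ [CM top-weight Hodge classes algebraic]`, granted [h₂₁], Verdier and `CMThetaGysinFib[]`.**
[cite: Andre1996Motifs, Lemme 6.3.1 (p. 31) and Remarque 2 (p. 33)] [cite: Verdier1976, Cor. 5.1] -/
theorem HC_AV_iff_HC_CM_and_cmTopWeightHodge_of_verdier_of_thetaGysinFib (h₂₁ : andre1996_cmAnchoredPencil)
    (hGT : Verdier1976_genericLocalTriviality) (hΘ : CMThetaGysinFib[]) :
    PadicSemiregularLift.HodgeAbelianVarieties ↔ (RankFourFaces.CMAbelianHodge ∧ CMTopWeightHodge[]) :=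
  HC_AV_iff_HC_CM_and_cmTopWeightHodge_of_verdier_of_thetaGysin h₂₁ hGT (cmThetaGysin_of_cmThetaGysinFib hΘ)

end Nodes

end Summit.HodgeConjecture.HodgeConjecture.Ring2.AbelianAll

end
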